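/-
Copyright: rh-split cell (screw, bridge) gen 17, 2026-08-27.  Splitting search over kernel-typed
RH-equivalences.  A splitting `A ∧ B ⟹ RH` is CONDITIONAL bookkeeping unless `A` and `B` are both
proved; nothing here bears on the truth of RH.
-/
import Summits.RiemannHypothesis.RiemannHypothesis.Theorems.Splittings.ScrewWolffDiscreteDataC

/-!
# The blind configuration B16′ is NON-Blaschke — part B of `ScrewBlaschkeTop.lean` (ζ-free)

Carve B of `ScrewBlaschkeTop.lean` (cell `rh-split`, (screw, bridge) gen 17, card §22): section 5 verbatim.
The divisor-ring atoms of `ScrewWolffDiscreteData` (which feed `ScrewLatticeWolffOneCircle.exists_blind_model_discrete`)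
have divergent depth sum `Σ (1 - ‖atom M i‖) = ∞`: each live ring has total depth `≥ 1/2` (Bernoulli) and there
are infinitely many live rings.  No `sorry`, no new axioms, no instances, no notation.
-/

set_option linter.dupNamespace false

namespace Summit.RiemannHypothesis.RiemannHypothesis.Theorems.Splittings.ScrewBlaschkeTop

open Summit.RiemannHypothesis.RiemannHypothesis.Theorems.Splittings
open Filter Topology

/-! ## 5. The blind configuration B16′ is NON-Blaschke (kernel certificate)

The divisor-ring data of `ScrewWolffDiscreteData` (atoms `atom M i` in the unit disc, live ring `n` =
`n·M` atoms on the circle of radius `q^{1/(nM)}`, `q = 1/16`, infinitely many live rings) feed B16′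
`ScrewLatticeWolffOneCircle.exists_blind_model_discrete` with abscissae `Re κ = σ* + log ‖atom‖ / h`, so
`σ* - Re κ_i = -log ‖atom M i‖ / h ≥ (1 - ‖atom M i‖)/h`.  Each live ring has total depth `≥ 1/2`
(Bernoulli), hence the depth sum diverges: the top layer of B16′ violates `BL` in every band, exactly as
T-BL demands of a blind configuration. -/

section NonBlaschke

open ScrewWolffDiscreteData

/-- Depth of ring `n`: `1/(2 n M) ≤ 1 - q^{1/(nM)}` (Bernoulli's inequality and `q = 1/16 < 1/2`). -/
theorem one_sub_rad_ge {n M : ℕ} (hn : 1 ≤ n) (hM : 1 ≤ M) :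
    1 / (2 * ((n : ℝ) * M)) ≤ 1 - rad n M := by
  set N : ℕ := n * M with hN
  have hN1 : 1 ≤ N := Nat.one_le_iff_ne_zero.2 (Nat.mul_ne_zero (by omega) (by omega))
  have hNr : (1 : ℝ) ≤ N := by exact_mod_cast hN1
  have hNeq : ((n : ℝ) * M) = N := by rw [hN]; push_cast; ring
  rw [hNeq]
  have hle : 1 / (2 * (N : ℝ)) ≤ 1 / 2 := one_div_le_one_div_of_le (by norm_num) (by linarith)
  by_contra hlt
  push Not at hlt
  have hr : 1 - 1 / (2 * (N : ℝ)) ≤ rad n M := by linarith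
  have h0 : (0 : ℝ) ≤ 1 - 1 / (2 * N) := by linarith
  have hpow : (1 - 1 / (2 * (N : ℝ))) ^ N ≤ rad n M ^ N := pow_le_pow_left₀ h0 hr N
  have hbern : 1 + (N : ℝ) * (-(1 / (2 * N))) ≤ (1 + -(1 / (2 * (N : ℝ)))) ^ N :=
    one_add_mul_le_pow (by linarith) N
  have hhalf : 1 + (N : ℝ) * (-(1 / (2 * N))) = 1 / 2 := by
    field_simp
    ring
  have hq : rad n M ^ N = q := by
    have h1 := rad_pow n M 1 hn hM
    rw [mul_one, pow_one, ← hN] at h1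
    exact h1
  have hq' : (1 : ℝ) / 2 ≤ q := by
    calc (1 : ℝ) / 2 = 1 + (N : ℝ) * (-(1 / (2 * N))) := hhalf.symm
      _ ≤ (1 + -(1 / (2 * (N : ℝ)))) ^ N := hbern
      _ = (1 - 1 / (2 * (N : ℝ))) ^ N := by ring
      _ ≤ rad n M ^ N := hpow
      _ = q := hq
  norm_num [q] at hq'

/-- The live rings form an infinite type. -/
theorem infinite_live : Infinite Live := by
  have h : Set.Infinite {n : ℕ | coef n ≠ 0} := Set.infinite_of_not_bddAbove fun ⟨B, hB⟩ ↦ by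
    obtain ⟨n, hBn, hn⟩ := exists_live_gt B
    exact absurd (hB hn) (not_le.2 hBn)
  exact h.to_subtype

/-- **B16′'s data are non-Blaschke:** the depths `1 - ‖atom M i‖` of the divisor-ring atoms are NOT
summable (`M ≥ 1`). -/
theorem not_summable_one_sub_norm_atom {M : ℕ} (hM : 1 ≤ M) :
    ¬ Summable (fun i : Idx M ↦ 1 - ‖atom M i‖) := by
  intro hs
  have hs' : Summable (fun x : (Σ n : Live, Fin (n.1 * M)) ↦ 1 - ‖atom M (Sum.inr x)‖) :=
    hs.comp_injective Sum.inr_injective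
  have hnn : ∀ x : (Σ n : Live, Fin (n.1 * M)), 0 ≤ 1 - ‖atom M (Sum.inr x)‖ := fun x ↦ by
    rw [norm_atom]
    exact sub_nonneg.2 (rad_lt_one (one_le_level _) hM).le
  have hring : Summable fun n : Live ↦ ∑' l : Fin (n.1 * M), (1 - ‖atom M (Sum.inr ⟨n, l⟩)‖) :=
    ((summable_sigma_of_nonneg hnn).1 hs').2
  have hge : ∀ n : Live, (1 : ℝ) / 2 ≤ ∑' l : Fin (n.1 * M), (1 - ‖atom M (Sum.inr ⟨n, l⟩)‖) := by
    intro n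
    have hn : 1 ≤ n.1 := le_trans (by norm_num) (coef_ne_zero_two_le n.2)
    have hterm : ∀ l : Fin (n.1 * M), 1 - ‖atom M (Sum.inr ⟨n, l⟩)‖ = 1 - rad n.1 M := by
      intro l
      rw [norm_atom]
      rfl
    rw [tsum_fintype]
    simp only [hterm, Finset.sum_const, Finset.card_univ, Fintype.card_fin, nsmul_eq_mul]
    have h1 := one_sub_rad_ge hn hM
    have hn' : (1 : ℝ) ≤ n.1 := by exact_mod_cast hn
    have hM' : (1 : ℝ) ≤ M := by exact_mod_cast hM
    have hpos : (0 : ℝ) < (n.1 : ℝ) * M := by positivity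
    calc (1 : ℝ) / 2 = ((n.1 * M : ℕ) : ℝ) * (1 / (2 * ((n.1 : ℝ) * M))) := by
          push_cast
          field_simp
      _ ≤ ((n.1 * M : ℕ) : ℝ) * (1 - rad n.1 M) :=
          mul_le_mul_of_nonneg_left h1 (by positivity)
  haveI := infinite_live
  have h0 := hring.tendsto_cofinite_zero
  have hev := h0.eventually (gt_mem_nhds (show (0 : ℝ) < 1 / 2 by norm_num))
  obtain ⟨n, hn⟩ := hev.exists
  exact absurd (hge n) (not_le.2 hn)

end NonBlaschke

end Summit.RiemannHypothesis.RiemannHypothesis.Theorems.Splittings.ScrewBlaschkeTop
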